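import Mathlib.RingTheory.MvPolynomial.Basic
import Mathlib.Algebra.MvPolynomial.Eval
import Literature.FieldTheory.AlgClosed.AutomorphismExtension
import Literature.NumberTheory.EllipticCurves.LatticeInclusionRigidityProofs
import Literature.NumberTheory.Transcendental.ExpVarieties
import Mathlib.FieldTheory.PrimeField
import HarnessLib

/-!
# Descent of polynomial relations on `Aut(ℂ)`-stable sets from `ℂ` to `ℚ`

If a subset `W ⊆ ℂ^ι` is stable under the coordinatewise action of every field automorphism of
`ℂ` (for instance a zero locus of polynomials with rational coefficients), and some NONZERO complex
polynomial `f` vanishes on `W`, then some nonzero RATIONAL polynomial `g` whose monomials are among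
those of `f` vanishes on `W` (`exists_rat_mvPolynomial_vanishing_of_autStable`).

Proof (minimal support, no linear algebra): among the nonzero complex polynomials supported on
`f.support` and vanishing on `W` pick one, `h`, with the fewest monomials and normalise one
coefficient to `1`; for `σ ∈ Aut(ℂ)` the coefficientwise conjugate `σh` again vanishes on `W`
(because `σ⁻¹ W ⊆ W`) and has the same support, so `σh − h` vanishes on `W` with strictly fewer
monomials, hence is `0`: every coefficient of `h` is fixed by `Aut(ℂ)`, i.e. rational
(`exists_ratCast_eq_of_forall_ringEquiv`, the tree's "fixed field of `Aut(ℂ)` is `ℚ`").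

This is the elementary descent step used to pass from "the coordinates of a ℚ-variety of
dimension `< 2` are pairwise algebraically dependent over `ℂ`" to "… over `ℚ`" (crux
`RigidCore.SparsityTwo`, line cusp-germ-schneider-sparsity, arithmetic normal form of a cusp germ).

## References

* [folklore] Galois descent for vector spaces with a rational structure, e.g. Lang, *Algebra*,
  Ch. VIII §1 / Borel, *Linear Algebraic Groups*, AG §14; here in the naive "minimal support" form.
-/

noncomputable section

open MvPolynomial

namespace Literature.NumberTheory.Transcendental

variable {ι : Type*}

/-- Coordinatewise action of a ring automorphism of `ℂ` on `ℂ^ι` commutes with evaluation of the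
coefficientwise conjugate polynomial: `σ (eval p h) = eval (σ ∘ p) (map σ h)`. [folklore] -/
theorem ringEquiv_apply_eval_eq_eval_map (σ : ℂ ≃+* ℂ) (p : ι → ℂ) (h : MvPolynomial ι ℂ) :
    σ (eval p h) = eval (fun i => σ (p i)) (map (σ : ℂ →+* ℂ) h) := by
  rw [eval_map]
  change (σ : ℂ →+* ℂ) (eval₂ (RingHom.id ℂ) p h) = _
  rw [eval₂_comp_left]
  rfl

/-- **Descent of a vanishing polynomial relation from `ℂ` to `ℚ` on an `Aut(ℂ)`-stable set.**
Let `W ⊆ ℂ^ι` be stable under `p ↦ σ ∘ p` for every field automorphism `σ` of `ℂ`, and let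
`f ≠ 0` be a complex polynomial vanishing on `W`. Then there is a rational polynomial `g ≠ 0` with
`g.support ⊆ f.support` vanishing on `W`. [folklore] -/
theorem exists_rat_mvPolynomial_vanishing_of_autStable (W : Set (ι → ℂ))
    (hW : ∀ σ : ℂ ≃+* ℂ, ∀ p ∈ W, (fun i => σ (p i)) ∈ W)
    (f : MvPolynomial ι ℂ) (hf : f ≠ 0) (hfW : ∀ p ∈ W, eval p f = 0) :
    ∃ g : MvPolynomial ι ℚ, g ≠ 0 ∧ g.support ⊆ f.support ∧
      ∀ p ∈ W, aeval p g = 0 := by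
  classical
  -- the pool of admissible complex relations
  set V : Set (MvPolynomial ι ℂ) :=
    {h | h ≠ 0 ∧ h.support ⊆ f.support ∧ ∀ p ∈ W, eval p h = 0} with hV
  have hfV : f ∈ V := ⟨hf, subset_rfl, hfW⟩
  -- a relation with the fewest monomials
  have hex : ∃ n, ∃ h ∈ V, h.support.card = n := ⟨_, f, hfV, rfl⟩
  obtain ⟨h, hhV, hcard⟩ := Nat.find_spec hex
  have hmin : ∀ h' ∈ V, h.support.card ≤ h'.support.card := by
    intro h' hh'
    rw [hcard]
    exact Nat.find_min' hex ⟨h', hh', rfl⟩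
  obtain ⟨hh0, hhsupp, hhW⟩ := hhV
  -- normalise one coefficient to `1`
  obtain ⟨m₀, hm₀⟩ : h.support.Nonempty := support_nonempty.mpr hh0
  have hc₀ : h.coeff m₀ ≠ 0 := mem_support_iff.mp hm₀
  set h₁ : MvPolynomial ι ℂ := C (h.coeff m₀)⁻¹ * h with hh₁
  have hcoeff₁ : ∀ m, h₁.coeff m = (h.coeff m₀)⁻¹ * h.coeff m := fun m => by
    rw [hh₁, coeff_C_mul]
  have hsupp₁ : h₁.support = h.support := by
    ext m
    rw [mem_support_iff, mem_support_iff, hcoeff₁]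
    exact mul_ne_zero_iff.trans (and_iff_right (inv_ne_zero hc₀))
  have h₁m₀ : h₁.coeff m₀ = 1 := by rw [hcoeff₁, inv_mul_cancel₀ hc₀]
  have h₁W : ∀ p ∈ W, eval p h₁ = 0 := fun p hp => by
    rw [hh₁, map_mul, hhW p hp, mul_zero]
  -- every coefficient of `h₁` is fixed by `Aut(ℂ)`
  have hfix : ∀ (σ : ℂ ≃+* ℂ) (m : ι →₀ ℕ), σ (h₁.coeff m) = h₁.coeff m := by
    intro σ m
    -- the conjugate relation and the difference
    set hσ : MvPolynomial ι ℂ := map (σ : ℂ →+* ℂ) h₁ with hhσ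
    have hσcoeff : ∀ m, hσ.coeff m = σ (h₁.coeff m) := fun m => coeff_map _ _ _
    have hσW : ∀ p ∈ W, eval p hσ = 0 := by
      intro p hp
      have hq : (fun i => σ.symm (p i)) ∈ W := hW σ.symm p hp
      have := ringEquiv_apply_eval_eq_eval_map σ (fun i => σ.symm (p i)) h₁
      simp only [RingEquiv.apply_symm_apply] at this
      rw [hhσ, ← this, h₁W _ hq, map_zero]
    set d : MvPolynomial ι ℂ := hσ - h₁ with hd
    have hdcoeff : ∀ m, d.coeff m = σ (h₁.coeff m) - h₁.coeff m := fun m => by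
      rw [hd, coeff_sub, hσcoeff]
    by_contra hne
    have hd0 : d ≠ 0 := by
      intro h0
      have := hdcoeff m
      rw [h0, coeff_zero] at this
      exact hne (sub_eq_zero.mp this.symm)
    -- `d` is admissible with support inside `h.support \ {m₀}`
    have hdsupp : d.support ⊆ h.support.erase m₀ := by
      intro m' hm'
      rw [mem_support_iff, hdcoeff] at hm'
      rw [Finset.mem_erase]
      refine ⟨?_, ?_⟩
      · rintro rfl
        rw [h₁m₀, map_one, sub_self] at hm'
        exact hm' rfl
      · rw [← hsupp₁, mem_support_iff]
        intro h0
        rw [h0, map_zero, sub_self] at hm'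
        exact hm' rfl
    have hdV : d ∈ V := by
      refine ⟨hd0, hdsupp.trans ((Finset.erase_subset _ _).trans hhsupp), fun p hp => ?_⟩
      rw [hd, map_sub, hσW p hp, h₁W p hp, sub_self]
    have hlt : d.support.card < h.support.card :=
      (Finset.card_le_card hdsupp).trans_lt (Finset.card_erase_lt_of_mem hm₀)
    exact absurd (hmin d hdV) (not_le.mpr hlt)
  -- hence rational
  have hrat : ∀ m, ∃ q : ℚ, (q : ℂ) = h₁.coeff m := fun m =>
    Literature.NumberTheory.EllipticCurves.exists_ratCast_eq_of_forall_ringEquiv (fun σ => hfix σ m)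
  choose q hq using hrat
  -- the rational polynomial with these coefficients
  let g : MvPolynomial ι ℚ := ∑ m ∈ h₁.support, monomial m (q m)
  have hgcoeff : ∀ m, g.coeff m = if m ∈ h₁.support then q m else 0 := by
    intro m
    simp only [g, coeff_sum, coeff_monomial]
    rw [Finset.sum_ite_eq']
  have hmapg : map (algebraMap ℚ ℂ) g = h₁ := by
    ext m
    rw [coeff_map, hgcoeff]
    split_ifs with hm
    · rw [eq_ratCast, hq]
    · rw [map_zero]
      exact (notMem_support_iff.mp hm).symm
  refine ⟨g, ?_, ?_, ?_⟩
  · intro hg0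
    have := congrArg (coeff m₀) hmapg
    rw [hg0, map_zero, coeff_zero, h₁m₀] at this
    exact zero_ne_one this
  · intro m hm
    rw [mem_support_iff, hgcoeff] at hm
    split_ifs at hm with hm'
    · exact hhsupp (hsupp₁ ▸ hm')
    · exact absurd rfl hm
  · intro p hp
    rw [aeval_def, ← eval_map, hmapg]
    exact h₁W p hp

/-- A field automorphism of `ℂ` fixes the prime subfield `⊥ = ℚ` pointwise. [folklore] -/
theorem ringEquiv_apply_eq_self_of_mem_bot (σ : ℂ ≃+* ℂ) {z : ℂ} (hz : z ∈ (⊥ : Subfield ℂ)) :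
    σ z = z := by
  rw [Subfield.bot_eq_of_charZero, RingHom.mem_fieldRange] at hz
  obtain ⟨r, rfl⟩ := hz
  simp

/-- **A set defined over `ℚ` is `Aut(ℂ)`-stable**: if `W ⊆ ℂ^ι` is the zero locus of polynomials
with coefficients in the prime field (`IsDefinedOver ⊥ W`), then `σ ∘ p ∈ W` for every `p ∈ W`
and every field automorphism `σ` of `ℂ`. [folklore] -/
theorem IsDefinedOver.ringEquiv_comp_mem {W : Set (ι → ℂ)}
    (hW : IsDefinedOver (⊥ : Subfield ℂ) W) (σ : ℂ ≃+* ℂ) {p : ι → ℂ} (hp : p ∈ W) :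
    (fun i => σ (p i)) ∈ W := by
  obtain ⟨I, rfl⟩ := hW
  simp only [MvPolynomial.mem_zeroLocus_iff] at hp ⊢
  intro q hq
  have hfix : (σ : ℂ →+* ℂ).comp (algebraMap (⊥ : Subfield ℂ) ℂ) =
      algebraMap (⊥ : Subfield ℂ) ℂ := by
    ext z
    exact ringEquiv_apply_eq_self_of_mem_bot σ z.2
  have h1 : σ (aeval p q) = aeval (fun i => σ (p i)) q := by
    rw [aeval_def, aeval_def]
    change (σ : ℂ →+* ℂ) (eval₂ _ p q) = _
    rw [eval₂_comp_left, hfix]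
    rfl
  rw [← h1, hp q hq, map_zero]

/-- **Rational relations on a ℚ-variety.** If `W` is defined over `ℚ` and a nonzero complex
polynomial `f` vanishes on `W`, then a nonzero rational polynomial supported on the monomials of
`f` vanishes on `W`. [folklore] -/
theorem IsDefinedOver.exists_rat_mvPolynomial_vanishing {W : Set (ι → ℂ)}
    (hW : IsDefinedOver (⊥ : Subfield ℂ) W) (f : MvPolynomial ι ℂ) (hf : f ≠ 0)
    (hfW : ∀ p ∈ W, eval p f = 0) :
    ∃ g : MvPolynomial ι ℚ, g ≠ 0 ∧ g.support ⊆ f.support ∧ ∀ p ∈ W, aeval p g = 0 :=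
  exists_rat_mvPolynomial_vanishing_of_autStable W (fun σ _ hp => hW.ringEquiv_comp_mem σ hp)
    f hf hfW

end Literature.NumberTheory.Transcendental

end
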